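import Literature.Computability.MetaComplexity.RefutationCNF
import Literature.Computability.MetaComplexity.ResolutionProofs
import HarnessLib

/-!
# Every Resolution refutation of `RREF(F,s)` has at least `s - 1` lines

An elementary length lower bound for the relativized refutation statement of
[Atserias–Müller 2020, §5]: for `F` with at least one variable, every Resolution refutation `π` of
`RREF(F,s) = rrefCNF F s` satisfies `s ≤ |π| + 1` (`le_length_of_isResRefutation_rrefCNF`).

The reason is that `RREF(F,s)` has no small unsatisfiable core: writing `T` for the last line
(`T + 1 = s`), if a set of clauses of `RREF(F,s)` omits the activity clause
(A22) `¬P[T] ∨ ¬L[T,v₀] ∨ P[v₀]` for some `v₀ < T` and the clause (A23) `¬P[T] ∨ ¬R[T,v₁] ∨ P[v₁]`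
for some `v₁ < T`, then it is satisfied by the assignment making only the last line active
(`P[u] ↔ u = T`, so that every clause guarded by some `¬P[u]`, `u ≠ T`, holds) and describing the
last line as an empty clause obtained by a cut on `X_1` with premises `L(T) = v₀`, `R(T) = v₁`,
`I(T) = 0` (`RefCNF.exists_eval_rref_of_ne`). The initial clauses of a refutation form an
unsatisfiable core (soundness), hence contain all `T` clauses (A22) of line `T` or all `T` clauses
(A23) of line `T`, which are pairwise distinct.

This bound is not in [AM20]; it is recorded here because it closes a gap in the arithmetic of the
proof of [AM20, Lemma 10] as printed in arXiv:1904.02991 (§5: "`ℓ·(3/4)^w` … is strictly less than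
`1/4` for `ℓ ≤ 2^{2w/5}` (here we use that `w ≥ 20`)" — in fact `2^{2w/5}(3/4)^w < 1/4` only for
`w ≥ 134`): for `20 ≤ w < 134` the asserted bound `2^{2w/5} < 2⁵⁴` on the length of refutations of
`RREF(F, 13nw)` follows from the present one as soon as `13·n·20 - 1 ≥ 2⁵⁴`, i.e. for all large
`n`, so that the statement of [AM20, Lemma 10] (the named fact `rrefCNF_lowerBound`) is unaffected.

## References

* A. Atserias, M. Müller, *Automating Resolution is NP-hard*, J. ACM 67(5) (2020), Art. 31;
  arXiv:1904.02991, §5 (RREF, Lemma 10), Appendix (clauses (A1)–(A24)).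
* J. Krajíček, *Proof Complexity*, CUP 2019, §5.1 (soundness of resolution).
-/

namespace Literature.Computability.MetaComplexity

open _root_.Computability Complexity

/-! ### Refutations refute the sub-CNF of their initial clauses -/

/-- A derivation from `φ` is a derivation from any CNF containing (as set-clauses) the clauses of
its `initial` lines. [Krajíček 2019, §5.1] [folklore] -/
theorem IsResDerivation.of_initial_mem {ν : Type*} [DecidableEq ν] {φ ψ : CNF ν}
    {π : List (ResLine ν)} (h : IsResDerivation φ π)
    (hψ : ∀ l ∈ π, l.rule = ResRule.initial → l.clause ∈ ψ.clauseFinsets) :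
    IsResDerivation ψ π := by
  intro k hk
  have hv := h k hk
  have hmem : π[k] ∈ π := List.getElem_mem hk
  revert hv
  unfold IsValidResLine
  cases hr : (π[k]'hk).rule with
  | initial => exact fun _ => hψ _ hmem hr
  | resolve i j v => exact id
  | weaken i => exact id

/-- The number of lines of a derivation is at least the number of distinct clauses of its
`initial` lines. [folklore] -/
theorem card_initialClauses_le_length {ν : Type*} [DecidableEq ν] (π : List (ResLine ν)) :
    ((π.filter fun l => decide (l.rule = ResRule.initial)).map ResLine.clause).toFinset.card ≤
      π.length :=
  (List.toFinset_card_le _).trans (by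
    rw [List.length_map]
    exact List.length_filter_le _ _)

namespace RefCNF

variable (X : List ℕ) (F : CNF ℕ)

/-! ### The assignment activating only the last line -/

/-- Dispatching membership in `rref` to one of its 24 families. [folklore] -/
theorem mem_rref_iff_families (s : ℕ) (c : Clause RefVar) :
    c ∈ rref X F s ↔
      c ∈ A1 true s X.length ∨ c ∈ A2 true s F.length ∨ c ∈ A3 true s ∨ c ∈ A4 true s ∨
      c ∈ A5 true s X.length ∨ c ∈ A6 true s F.length ∨ c ∈ A7 true s ∨ c ∈ A8 true s ∨
      c ∈ A9 true s ∨ c ∈ A10 true s ∨ c ∈ A11 true s ∨ c ∈ A12 true s ∨ c ∈ A13 true s ∨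
      c ∈ A14 true s ∨ c ∈ A15 true s X.length ∨ c ∈ A16 true s X.length ∨
      c ∈ A17 true s X.length ∨ c ∈ A18 true s X.length ∨ c ∈ A19 true X F s ∨
      c ∈ A20 true s X.length ∨ c ∈ A21 true s X.length ∨
      c ∈ A22 s ∨ c ∈ A23 s ∨ c ∈ A24 s := by
  simp only [rref_eq, blocks, List.mem_append, or_assoc]

/-- **No small unsatisfiable core**: if `T` is the last line (`T + 1 = s`), `v₀, v₁ < T` and
`n ≥ 1`, then some assignment satisfies every clause of `RREF(F,s)` other than the two activity
clauses (A22) `¬P[T] ∨ ¬L[T,v₀] ∨ P[v₀]` and (A23) `¬P[T] ∨ ¬R[T,v₁] ∨ P[v₁]` — namely the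
assignment with `P[u] ↔ u = T`, all `D` false, `V(u) = X_1`, `I(u) = 0`, `L(u) = v₀`, `R(u) = v₁`.
[cite: AtseriasMuller2020, §5 (clauses of RREF: every clause mentioning a line u other than (A24)
carries ¬P[u] or is ¬P[u] ∨ ¬L[u,v] ∨ P[v])] -/
theorem exists_eval_rref_of_ne {s T v₀ v₁ : ℕ} (hT : T + 1 = s) (hv₀ : v₀ < T) (hv₁ : v₁ < T)
    (hn : 1 ≤ X.length) :
    ∃ σ : RefVar → Bool, ∀ c ∈ rref X F s,
      c ≠ [(RefVar.P T, false), (RefVar.L T (some v₀), false), (RefVar.P v₀, true)] →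
      c ≠ [(RefVar.P T, false), (RefVar.R T (some v₁), false), (RefVar.P v₁, true)] →
        Clause.eval σ c = true := by
  obtain ⟨σ, hP, hD, hV, hI, hL, hR⟩ : ∃ σ : RefVar → Bool,
      (∀ u, σ (RefVar.P u) = decide (u = T)) ∧ (∀ u i b, σ (RefVar.D u i b) = false) ∧
      (∀ u o, σ (RefVar.V u o) = decide (o = some 0)) ∧
      (∀ u o, σ (RefVar.I u o) = decide (o = none)) ∧
      (∀ u o, σ (RefVar.L u o) = decide (o = some v₀)) ∧
      (∀ u o, σ (RefVar.R u o) = decide (o = some v₁)) :=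
    ⟨fun x => match x with
      | .P u => decide (u = T)
      | .D _ _ _ => false
      | .V _ o => decide (o = some 0)
      | .I _ o => decide (o = none)
      | .L _ o => decide (o = some v₀)
      | .R _ o => decide (o = some v₁),
     fun _ => rfl, fun _ _ _ => rfl, fun _ _ => rfl, fun _ _ => rfl, fun _ _ => rfl, fun _ _ => rfl⟩
  refine ⟨σ, ?_⟩
  -- a clause is true as soon as it contains a true literal
  have ev : ∀ (c : Clause RefVar) (l : Literal RefVar), l ∈ c → Literal.eval σ l = true →
      Clause.eval σ c = true :=
    fun c l hl h => List.any_eq_true.2 ⟨l, hl, h⟩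
  -- the guard `¬P[u]` of a line `u ≠ T` is true
  have guard : ∀ (u : ℕ) (rest : Clause RefVar), u ≠ T →
      Clause.eval σ (pfx true u ++ rest) = true := fun u rest hu =>
    ev _ (RefVar.P u, false) (by simp [pfx]) (by simp [Literal.eval, hP, hu])
  have guard' : ∀ (u v : ℕ) (rest : Clause RefVar), v ≠ T →
      Clause.eval σ (pfx true u ++ pfx true v ++ rest) = true := fun u v rest hv =>
    ev _ (RefVar.P v, false) (by simp [pfx]) (by simp [Literal.eval, hP, hv])
  have hv₀T : v₀ ≠ T := Nat.ne_of_lt hv₀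
  have hv₁T : v₁ ≠ T := Nat.ne_of_lt hv₁
  intro c hc h22 h23
  rw [mem_rref_iff_families] at hc
  rcases hc with hc | hc | hc | hc | hc | hc | hc | hc | hc | hc | hc | hc | hc | hc | hc | hc |
    hc | hc | hc | hc | hc | hc | hc | hc
  · -- (A1): `V[T,1]`
    obtain ⟨u, -, rfl⟩ := List.mem_map.1 hc
    by_cases hu : u = T
    · refine ev _ (RefVar.V u (some 0), true) (List.mem_append_right _ (List.mem_map.2
        ⟨some 0, List.mem_cons_of_mem _ (List.mem_map.2 ⟨0, List.mem_range.2 hn, rfl⟩), rfl⟩)) ?_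
      simp [Literal.eval, hV]
    · exact guard u _ hu
  · -- (A2): `I[T,0]`
    obtain ⟨u, -, rfl⟩ := List.mem_map.1 hc
    by_cases hu : u = T
    · exact ev _ (RefVar.I u none, true)
        (List.mem_append_right _ (List.mem_map.2 ⟨none, List.mem_cons_self, rfl⟩))
        (by simp [Literal.eval, hI])
    · exact guard u _ hu
  · -- (A3): `L[T,v₀]`
    obtain ⟨u, -, rfl⟩ := List.mem_map.1 hc
    by_cases hu : u = T
    · refine ev _ (RefVar.L u (some v₀), true) (List.mem_append_right _ (List.mem_map.2
        ⟨some v₀, List.mem_cons_of_mem _ (List.mem_map.2 ⟨v₀, List.mem_range.2 (by omega), rfl⟩),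
          rfl⟩)) ?_
      simp [Literal.eval, hL]
    · exact guard u _ hu
  · -- (A4): `R[T,v₁]`
    obtain ⟨u, -, rfl⟩ := List.mem_map.1 hc
    by_cases hu : u = T
    · refine ev _ (RefVar.R u (some v₁), true) (List.mem_append_right _ (List.mem_map.2
        ⟨some v₁, List.mem_cons_of_mem _ (List.mem_map.2 ⟨v₁, List.mem_range.2 (by omega), rfl⟩),
          rfl⟩)) ?_
      simp [Literal.eval, hR]
    · exact guard u _ hu
  · -- (A5): at most one value of `V`
    simp only [A5, List.mem_flatMap, List.mem_map, List.mem_filter] at hc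
    obtain ⟨u, -, i, -, i', ⟨-, hii'⟩, rfl⟩ := hc
    by_cases hu : u = T
    · by_cases hi : i = some 0
      · subst hi
        have hi' : i' ≠ some 0 := by simpa using hii'
        exact ev _ (RefVar.V u i', false) (by simp) (by simp [Literal.eval, hV, hi'])
      · exact ev _ (RefVar.V u i, false) (by simp) (by simp [Literal.eval, hV, hi])
    · exact guard u _ hu
  · -- (A6): at most one value of `I`
    simp only [A6, List.mem_flatMap, List.mem_map, List.mem_filter] at hc
    obtain ⟨u, -, j, -, j', ⟨-, hjj'⟩, rfl⟩ := hc
    by_cases hu : u = T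
    · by_cases hj : j = none
      · subst hj
        have hj' : j' ≠ none := by simpa using hjj'
        exact ev _ (RefVar.I u j', false) (by simp) (by simp [Literal.eval, hI, hj'])
      · exact ev _ (RefVar.I u j, false) (by simp) (by simp [Literal.eval, hI, hj])
    · exact guard u _ hu
  · -- (A7): at most one value of `L`
    simp only [A7, List.mem_flatMap, List.mem_map, List.mem_filter] at hc
    obtain ⟨u, -, v, -, v', ⟨-, hvv'⟩, rfl⟩ := hc
    by_cases hu : u = T
    · by_cases hv : v = some v₀
      · subst hv
        have hv' : v' ≠ some v₀ := by simpa using hvv'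
        exact ev _ (RefVar.L u v', false) (by simp) (by simp [Literal.eval, hL, hv'])
      · exact ev _ (RefVar.L u v, false) (by simp) (by simp [Literal.eval, hL, hv])
    · exact guard u _ hu
  · -- (A8): at most one value of `R`
    simp only [A8, List.mem_flatMap, List.mem_map, List.mem_filter] at hc
    obtain ⟨u, -, v, -, v', ⟨-, hvv'⟩, rfl⟩ := hc
    by_cases hu : u = T
    · by_cases hv : v = some v₁
      · subst hv
        have hv' : v' ≠ some v₁ := by simpa using hvv'
        exact ev _ (RefVar.R u v', false) (by simp) (by simp [Literal.eval, hR, hv'])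
      · exact ev _ (RefVar.R u v, false) (by simp) (by simp [Literal.eval, hR, hv])
    · exact guard u _ hu
  · -- (A9): `¬V[T,0]`
    obtain ⟨u, -, rfl⟩ := List.mem_map.1 hc
    by_cases hu : u = T
    · exact ev _ (RefVar.V u none, false) (by simp) (by simp [Literal.eval, hV])
    · exact guard u _ hu
  · -- (A10): `I[T,0]`
    obtain ⟨u, -, rfl⟩ := List.mem_map.1 hc
    by_cases hu : u = T
    · exact ev _ (RefVar.I u none, true) (by simp) (by simp [Literal.eval, hI])
    · exact guard u _ hu
  · -- (A11): `¬L[T,0]`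
    obtain ⟨u, -, rfl⟩ := List.mem_map.1 hc
    by_cases hu : u = T
    · exact ev _ (RefVar.L u none, false) (by simp) (by simp [Literal.eval, hL])
    · exact guard u _ hu
  · -- (A12): `¬R[T,0]`
    obtain ⟨u, -, rfl⟩ := List.mem_map.1 hc
    by_cases hu : u = T
    · exact ev _ (RefVar.R u none, false) (by simp) (by simp [Literal.eval, hR])
    · exact guard u _ hu
  · -- (A13): `¬L[T,v]` for `v ≥ T`, true as `L(T) = v₀ < T`
    simp only [A13, List.mem_flatMap, List.mem_map, List.mem_filter, List.mem_range] at hc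
    obtain ⟨u, -, v, ⟨-, huv⟩, rfl⟩ := hc
    by_cases hu : u = T
    · have huv' : u ≤ v := by simpa using huv
      have hne : v ≠ v₀ := by omega
      exact ev _ (RefVar.L u (some v), false) (by simp) (by simp [Literal.eval, hL, hne])
    · exact guard u _ hu
  · -- (A14): `¬R[T,v]` for `v ≥ T`
    simp only [A14, List.mem_flatMap, List.mem_map, List.mem_filter, List.mem_range] at hc
    obtain ⟨u, -, v, ⟨-, huv⟩, rfl⟩ := hc
    by_cases hu : u = T
    · have huv' : u ≤ v := by simpa using huv
      have hne : v ≠ v₁ := by omega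
      exact ev _ (RefVar.R u (some v), false) (by simp) (by simp [Literal.eval, hR, hne])
    · exact guard u _ hu
  · -- (A15): guards `¬P[u]`, `¬P[v]`, or `¬L[T,T]`
    simp only [A15, List.mem_flatMap, List.mem_map] at hc
    obtain ⟨u, -, v, -, i, -, rfl⟩ := hc
    by_cases hu : u = T
    · by_cases hv : v = T
      · have hne : v ≠ v₀ := by omega
        exact ev _ (RefVar.L u (some v), false) (by simp) (by simp [Literal.eval, hL, hne])
      · exact guard' u v _ hv
    · rw [List.append_assoc]; exact guard u _ hu
  · -- (A16)
    simp only [A16, List.mem_flatMap, List.mem_map] at hc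
    obtain ⟨u, -, v, -, i, -, rfl⟩ := hc
    by_cases hu : u = T
    · by_cases hv : v = T
      · have hne : v ≠ v₁ := by omega
        exact ev _ (RefVar.R u (some v), false) (by simp) (by simp [Literal.eval, hR, hne])
      · exact guard' u v _ hv
    · rw [List.append_assoc]; exact guard u _ hu
  · -- (A17)
    simp only [A17, List.mem_flatMap, List.mem_map] at hc
    obtain ⟨u, -, v, -, i, -, i', -, b, -, rfl⟩ := hc
    by_cases hu : u = T
    · by_cases hv : v = T
      · have hne : v ≠ v₀ := by omega
        exact ev _ (RefVar.L u (some v), false) (by simp) (by simp [Literal.eval, hL, hne])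
      · exact guard' u v _ hv
    · rw [List.append_assoc]; exact guard u _ hu
  · -- (A18)
    simp only [A18, List.mem_flatMap, List.mem_map] at hc
    obtain ⟨u, -, v, -, i, -, i', -, b, -, rfl⟩ := hc
    by_cases hu : u = T
    · by_cases hv : v = T
      · have hne : v ≠ v₁ := by omega
        exact ev _ (RefVar.R u (some v), false) (by simp) (by simp [Literal.eval, hR, hne])
      · exact guard' u v _ hv
    · rw [List.append_assoc]; exact guard u _ hu
  · -- (A19): `¬I[T,j]`
    simp only [A19, List.mem_flatMap, List.mem_map] at hc
    obtain ⟨u, -, j, -, l, -, rfl⟩ := hc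
    by_cases hu : u = T
    · exact ev _ (RefVar.I u (some j), false) (by simp) (by simp [Literal.eval, hI])
    · exact guard u _ hu
  · -- (A20): `¬D[T,i,0]`
    simp only [A20, List.mem_flatMap, List.mem_map] at hc
    obtain ⟨u, -, i, -, rfl⟩ := hc
    by_cases hu : u = T
    · exact ev _ (RefVar.D u i false, false) (by simp) (by simp [Literal.eval, hD])
    · exact guard u _ hu
  · -- (A21): `¬D[T,i,b]`
    simp only [A21, List.mem_flatMap, List.mem_map] at hc
    obtain ⟨u, -, i, -, b, -, rfl⟩ := hc
    exact ev _ (RefVar.D u i b, false) (by simp) (by simp [Literal.eval, hD])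
  · -- (A22): `¬P[u]`, or `¬L[T,v]` for `v ≠ v₀`; the clause for `(T, v₀)` is excluded
    simp only [A22, List.mem_flatMap, List.mem_map] at hc
    obtain ⟨u, -, v, -, rfl⟩ := hc
    by_cases hu : u = T
    · subst hu
      have hv : v ≠ v₀ := fun h => h22 (by rw [h])
      exact ev _ (RefVar.L u (some v), false) (by simp) (by simp [Literal.eval, hL, hv])
    · exact ev _ (RefVar.P u, false) (by simp) (by simp [Literal.eval, hP, hu])
  · -- (A23)
    simp only [A23, List.mem_flatMap, List.mem_map] at hc
    obtain ⟨u, -, v, -, rfl⟩ := hc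
    by_cases hu : u = T
    · subst hu
      have hv : v ≠ v₁ := fun h => h23 (by rw [h])
      exact ev _ (RefVar.R u (some v), false) (by simp) (by simp [Literal.eval, hR, hv])
    · exact ev _ (RefVar.P u, false) (by simp) (by simp [Literal.eval, hP, hu])
  · -- (A24): `P[T]`
    simp only [A24, List.mem_map, List.mem_filter, List.mem_range] at hc
    obtain ⟨u, ⟨-, hu⟩, rfl⟩ := hc
    have hu' : u = T := by simp at hu; omega
    exact ev _ (RefVar.P u, true) (by simp) (by simp [Literal.eval, hP, hu'])

/-! ### The length bound -/

/-- Evaluating a renumbered clause. [folklore] -/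
theorem clauseEval_map_code (σ : ℕ → Bool) (c : Clause RefVar) :
    Clause.eval σ (c.map fun l => ((l.1.code, l.2) : Literal ℕ)) =
      Clause.eval (fun x => σ x.code) c := by
  simp only [Clause.eval, List.any_map]
  rfl

/-- The renumbered activity clause (A22)/(A23) of the last line with premise `v`, as a
set-clause over `ℕ`. The map `v ↦` this clause is injective. [folklore] -/
theorem activity_toFinset_injective (T : ℕ) (mk : ℕ → Option ℕ → RefVar)
    (hmk : ∀ v v', mk T (some v) = mk T (some v') → v = v')
    (hmkP : ∀ v u, mk T (some v) ≠ RefVar.P u) :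
    Function.Injective fun v : ℕ =>
      ([(RefVar.P T, false), (mk T (some v), false), (RefVar.P v, true)].map
        fun l => ((l.1.code, l.2) : Literal ℕ)).toFinset := by
  intro v v' h
  have h' : ([(RefVar.P T, false), (mk T (some v), false), (RefVar.P v, true)].map
        fun l => ((l.1.code, l.2) : Literal ℕ)).toFinset =
      ([(RefVar.P T, false), (mk T (some v'), false), (RefVar.P v', true)].map
        fun l => ((l.1.code, l.2) : Literal ℕ)).toFinset := h
  have hmem : ((mk T (some v)).code, false) ∈
      ([(RefVar.P T, false), (mk T (some v'), false), (RefVar.P v', true)].map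
        fun l => ((l.1.code, l.2) : Literal ℕ)).toFinset := by
    rw [← h']; simp
  simp only [List.map_cons, List.map_nil, List.toFinset_cons, List.toFinset_nil,
    Finset.mem_insert, Prod.mk.injEq] at hmem
  rcases hmem with ⟨h1, -⟩ | ⟨h1, -⟩ | ⟨-, h2⟩ | h4
  · exact absurd (RefVar.code_injective h1) (hmkP v T)
  · exact hmk _ _ (RefVar.code_injective h1)
  · simp at h2
  · simp at h4

/-- **Every refutation of `RREF(F,s)` has at least `s - 1` lines** (for `F` with a variable): the
initial clauses of a refutation form an unsatisfiable core, which by `exists_eval_rref_of_ne` must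
contain all `s - 1` clauses (A22), or all `s - 1` clauses (A23), of the last line.
[cite: AtseriasMuller2020, §5 (structure of RREF; used here to patch the small-`w` range of the
arithmetic in the proof of Lemma 10)] -/
theorem le_length_of_isResRefutation_rrefCNF {F : CNF ℕ} {s : ℕ} (hn : 1 ≤ (CNF.vars F).card)
    {π : List (ResLine ℕ)} (hπ : IsResRefutation (rrefCNF F s) π) : s ≤ π.length + 1 := by
  rcases Nat.lt_or_ge s 2 with hs | hs
  · omega
  obtain ⟨T, rfl⟩ : ∃ T, s = T + 1 := ⟨s - 1, by omega⟩
  -- the initial clauses of `π`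
  set I : Finset (Finset (Literal ℕ)) :=
    ((π.filter fun l => decide (l.rule = ResRule.initial)).map ResLine.clause).toFinset with hI
  have hIcard : I.card ≤ π.length := card_initialClauses_le_length π
  -- the renumbered activity clauses of the last line
  let a22 : ℕ → Finset (Literal ℕ) := fun v =>
    ([(RefVar.P T, false), (RefVar.L T (some v), false), (RefVar.P v, true)].map
      fun l => ((l.1.code, l.2) : Literal ℕ)).toFinset
  let a23 : ℕ → Finset (Literal ℕ) := fun v =>
    ([(RefVar.P T, false), (RefVar.R T (some v), false), (RefVar.P v, true)].map
      fun l => ((l.1.code, l.2) : Literal ℕ)).toFinset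
  -- the core property
  have hcore : (∀ v < T, a22 v ∈ I) ∨ (∀ v < T, a23 v ∈ I) := by
    by_contra hcon
    rw [not_or] at hcon
    obtain ⟨h1, h2⟩ := hcon
    push Not at h1 h2
    obtain ⟨v₀, hv₀, hv₀I⟩ := h1
    obtain ⟨v₁, hv₁, hv₁I⟩ := h2
    obtain ⟨σ, hσ⟩ := exists_eval_rref_of_ne (sortedVars F) F rfl hv₀ hv₁
      (by rwa [length_sortedVars])
    -- `π` refutes the sub-CNF of its initial clauses, which `σ ∘ decode` satisfies
    set ψ : CNF ℕ := (rrefCNF F (T + 1)).filter fun c => decide (c.toFinset ∈ I) with hψ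
    have hπψ : IsResRefutation ψ π := by
      refine ⟨hπ.1.of_initial_mem fun l hl hr => ?_, hπ.2⟩
      obtain ⟨k, hk, rfl⟩ := List.getElem_of_mem hl
      have hval := hπ.1 k hk
      unfold IsValidResLine at hval
      simp only [hr] at hval
      obtain ⟨c, hc, hcl⟩ := List.mem_map.1 hval
      refine List.mem_map.2 ⟨c, List.mem_filter.2 ⟨hc, ?_⟩, hcl⟩
      rw [decide_eq_true_eq, hcl, hI, List.mem_toFinset]
      exact List.mem_map.2 ⟨π[k], List.mem_filter.2 ⟨hl, by simp [hr]⟩, rfl⟩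
    refine not_satisfiable_of_isResRefutation_holds hπψ ⟨fun k => σ (RefVar.decode k), ?_⟩
    rw [CNF.eval_eq_true_iff]
    intro c hc
    rw [hψ, List.mem_filter, decide_eq_true_eq] at hc
    obtain ⟨hc, hcI⟩ := hc
    rw [rrefCNF_eq, toNat] at hc
    obtain ⟨c₀, hc₀, rfl⟩ := List.mem_map.1 hc
    rw [clauseEval_map_code]
    simp only [RefVar.decode_code]
    refine hσ c₀ hc₀ (fun h => hv₀I ?_) (fun h => hv₁I ?_)
    · rw [h] at hcI; exact hcI
    · rw [h] at hcI; exact hcI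
  -- counting: `T` distinct clauses among the initial ones
  have h22inj : Function.Injective a22 :=
    activity_toFinset_injective T RefVar.L (fun v v' h => by simpa using h) (fun v u h => by simp at h)
  have h23inj : Function.Injective a23 :=
    activity_toFinset_injective T RefVar.R (fun v v' h => by simpa using h) (fun v u h => by simp at h)
  rcases hcore with h | h
  · have hsub : (Finset.range T).image a22 ⊆ I := by
      intro x hx
      obtain ⟨v, hv, rfl⟩ := Finset.mem_image.1 hx
      exact h v (Finset.mem_range.1 hv)
    have := Finset.card_le_card hsub
    rw [Finset.card_image_of_injective _ h22inj, Finset.card_range] at this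
    omega
  · have hsub : (Finset.range T).image a23 ⊆ I := by
      intro x hx
      obtain ⟨v, hv, rfl⟩ := Finset.mem_image.1 hx
      exact h v (Finset.mem_range.1 hv)
    have := Finset.card_le_card hsub
    rw [Finset.card_image_of_injective _ h23inj, Finset.card_range] at this
    omega

/-- The same bound for the minimal refutation size: `T ≤ minResRefutationSize (RREF(F, T+1))`.
[cite: AtseriasMuller2020, §5] -/
theorem le_minResRefutationSize_rrefCNF {F : CNF ℕ} (T : ℕ) (hn : 1 ≤ (CNF.vars F).card) :
    ((T : ℕ) : ℕ∞) ≤ minResRefutationSize (rrefCNF F (T + 1)) :=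
  le_iInf₂ fun π hπ => by
    exact_mod_cast (by have := le_length_of_isResRefutation_rrefCNF hn hπ; omega : T ≤ π.length)

end RefCNF

end Literature.Computability.MetaComplexity
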